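import Summits.HubbardSuperconductivity.HubbardLadder.Bounds.StiffnessCeilingsProofs
import Summits.HubbardSuperconductivity.HubbardLadder.Bounds.KinWeightXCeilingProof
import Literature.MathematicalPhysics.QuantumLattice.HubbardNNNHopping
import Literature.MathematicalPhysics.QuantumLattice.HubbardLiebTwoHoppingsSector
import HarnessLib

/-!
# Hubbard ladder — Bounds: the `t–t'` kinetic-weight ceiling, part 1/2 (symmetry toolbox)

HONEST FRAMING (cell pub-hubbard): ladder R1–R4 with certified numbers; no claim on H/H₀.
(The bounds seat's `KinWeightCeilingTPrime` split in two for the 400-line limit, statements unchanged;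
part 2 = `KinWeightCeilingTPrime` holds the shift matrices, the `t–t'` symbol matrix `M_c(t')`, the summed
bathtub bound `kinWeightTT'_sum_le` and `groundStateKinWeightCeilingTT'_holds`, with the full overview.)

This part: the rotation `r ∈ D₄` acts on torus sites as `rotSite`, preserves the diagonal bond graph
(`torusDiagGraph_adj_rotSite_iff`, `fermionTorusDiagGraph_adj_rot`), hence `Γ(r)` commutes with the `t–t'`
torus Hamiltonian `hubbardTorusTT' L t t' U` (`fockMapOp_rot_mul_hubbardTorusTT'`; Xu et al., Science 384
(2024), eq. (1) for the model) and maps sector ground states to sector ground states; the jump kinetic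
weights `K_j(ψ) = Σ_{z,σ} Re⟨ψ, c†_{z+j,σ} c_{z,σ} ψ⟩` (`shiftKinWeight`), `K_diag = K_{e₁+e₂} + K_{e₁-e₂}`
(`kinWeightDiag`) with `K_{rot j}(Γ(r)ψ) = K_j(ψ)` and `K_diag(Γ(r)ψ) = K_diag(ψ)`; the `t–t'` symbol
`w_c(k) = c (2 cos k₁ + 2 cos k₂ + 8 t' cos k₁ cos k₂)` (`ttSymbol`) and its bathtub weight (`ttBathtub`).
Sources as in part 2: [HVR2019] eqs. (2)–(6), [PTR1998], [LiebLoss2001] Thm 1.14, [XuEtAl2024] eq. (1),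
[Scalapino1995] §2.
-/

noncomputable section

namespace Summit.HubbardSuperconductivity.HubbardLadder.Bounds

open Matrix Finset Real
open Literature.MathematicalPhysics.QuantumLattice
open Literature.MathematicalPhysics.QuantumFieldTheory
open Literature.Probability.LatticeModels
open Literature.MathematicalPhysics.QuantumLattice.LangerMattis
open Literature.MathematicalPhysics.QuantumLattice.RayleighBound
open scoped ComplexOrder ComplexConjugate

variable {L : ℕ}

/-- The generator `r` of `D₄` acts on torus sites as `rotSite`. -/
private theorem d4Site_r_one_eq' (x : TorusSite 2 L) :
    d4Site (DihedralGroup.r 1 : DihedralGroup 4) x = rotSite x := by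
  simp only [d4Site]
  rw [show (1 : ZMod 4).val = 1 by decide, Function.iterate_one]

/-- `rot (e₁ - e₂) = e₁ + e₂`. -/
theorem rotSite_torusDiagJump_one : rotSite (torusDiagJump L 1) = torusDiagJump L 0 := by
  funext i; fin_cases i <;> simp [rotSite, torusDiagJump]

/-- `rot (e₁ + e₂) = -(e₁ - e₂)`. -/
theorem rotSite_torusDiagJump_zero : rotSite (torusDiagJump L 0) = -torusDiagJump L 1 := by
  funext i; fin_cases i <;> simp [rotSite, torusDiagJump]

/-- `rot (-(e₁ + e₂)) = e₁ - e₂`. -/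
theorem rotSite_neg_torusDiagJump_zero : rotSite (-torusDiagJump L 0) = torusDiagJump L 1 := by
  funext i; fin_cases i <;> simp [rotSite, torusDiagJump]

/-- `rot⁴ = id` on torus sites. -/
theorem rotSite_iterate_four (x : TorusSite 2 L) :
    rotSite (rotSite (rotSite (rotSite x))) = x := by
  funext i; fin_cases i <;> simp [rotSite]

/-- The diagonal bond graph is rotation invariant (one direction). -/
theorem torusDiagGraph_adj_rotSite {x y : TorusSite 2 L} (h : (torusDiagGraph L).Adj x y) :
    (torusDiagGraph L).Adj (rotSite x) (rotSite y) := by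
  rw [torusDiagGraph, SimpleGraph.fromRel_adj] at h ⊢
  obtain ⟨hne, h⟩ := h
  refine ⟨fun h' => hne (rotSite_injective h'), ?_⟩
  simp only [Fin.exists_fin_two] at h ⊢
  rcases h with (rfl | rfl) | (rfl | rfl)
  · exact Or.inr (Or.inr (by
      rw [rotSite_add, rotSite_torusDiagJump_zero, neg_add_cancel_right]))
  · exact Or.inl (Or.inl (by rw [rotSite_add, rotSite_torusDiagJump_one]))
  · exact Or.inl (Or.inr (by
      rw [rotSite_add, rotSite_torusDiagJump_zero, neg_add_cancel_right]))
  · exact Or.inr (Or.inl (by rw [rotSite_add, rotSite_torusDiagJump_one]))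

/-- The diagonal bond graph is rotation invariant. -/
theorem torusDiagGraph_adj_rotSite_iff (x y : TorusSite 2 L) :
    (torusDiagGraph L).Adj (rotSite x) (rotSite y) ↔ (torusDiagGraph L).Adj x y := by
  refine ⟨fun h => ?_, torusDiagGraph_adj_rotSite⟩
  simpa only [rotSite_iterate_four] using
    torusDiagGraph_adj_rotSite (torusDiagGraph_adj_rotSite (torusDiagGraph_adj_rotSite h))

/-- The symbol of `M_c(t')`: `w_c(k) = c (2 cos k₁ + 2 cos k₂ + 8 t' cos k₁ cos k₂)`. -/
def ttSymbol (c t' : ℝ) (k : TorusSite 2 L) : ℝ :=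
  c * (2 * Real.cos (latticeMomentum L k 0) + 2 * Real.cos (latticeMomentum L k 1) +
    8 * t' * (Real.cos (latticeMomentum L k 0) * Real.cos (latticeMomentum L k 1)))

/-- `torusDiagJump L 0 = e₁ + e₂`. -/
theorem torusDiagJump_zero_eq : torusDiagJump L 0 = Pi.single 0 1 + Pi.single 1 1 := by
  funext i; fin_cases i <;> simp [torusDiagJump]

/-- `torusDiagJump L 1 = e₁ - e₂`. -/
theorem torusDiagJump_one_eq : torusDiagJump L 1 = Pi.single 0 1 - Pi.single 1 1 := by
  funext i; fin_cases i <;> simp [torusDiagJump]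

/-- `min (-2x) 0 = -2 x⁺`. -/
private theorem min_neg_two_mul (x : ℝ) : min (-(2 * x)) 0 = -(2 * max x 0) := by
  rcases le_or_gt 0 x with h | h
  · rw [max_eq_left h, min_eq_left (by linarith)]
  · rw [max_eq_right h.le, min_eq_right (by linarith)]; ring

/-- The bathtub weight `(cos k₁ + cos k₂ + 4 t' cos k₁ cos k₂ - ν)⁺` of the `t–t'` symbol. -/
def ttBathtub (t' ν : ℝ) (k : TorusSite 2 L) : ℝ :=
  max (Real.cos (latticeMomentum L k 0) + Real.cos (latticeMomentum L k 1) +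
    4 * t' * (Real.cos (latticeMomentum L k 0) * Real.cos (latticeMomentum L k 1)) - ν) 0

/-- The Legendre form of the `t–t'` symbol at `c = -1`: `min (w₋₁(k) + 2ν) 0 = -2 (w(k)/2 - ν)⁺`. -/
theorem ttSymbol_neg_one_sub (t' ν : ℝ) (k : TorusSite 2 L) :
    min (ttSymbol (-1) t' k - -(2 * ν)) 0 = -(2 * ttBathtub t' ν k) := by
  rw [ttBathtub, ← min_neg_two_mul, ttSymbol]
  ring_nf

variable [NeZero L]

/-- The kinetic weight along a jump `j`: `K_j(ψ) = Σ_{z,σ} Re⟨ψ, c†_{z+j,σ} c_{z,σ} ψ⟩`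
(`kinWeightDir i = shiftKinWeight eᵢ` definitionally). -/
def shiftKinWeight (j : TorusSite 2 L) (ψ : Fock (Orb (FermionTorus 2 L))) : ℝ :=
  ∑ z : Site 2 L, ∑ σ : Fin 2,
    (star ψ ⬝ᵥ ((creation (orb (FermionTorus.ofTorusSite (z + j)) σ) *
      annihilation (orb (FermionTorus.ofTorusSite z) σ)) *ᵥ ψ)).re

/-- `K_{e_i} = kinWeightDir i` (definitionally). -/
theorem kinWeightDir_eq_shiftKinWeight (i : Fin 2) (ψ : Fock (Orb (FermionTorus 2 L))) :
    kinWeightDir i ψ = shiftKinWeight (Pi.single i 1) ψ := rfl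

/-- The diagonal kinetic weight, each diagonal bond once: `K_diag = K_{e₁+e₂} + K_{e₁-e₂}`. -/
def kinWeightDiag (ψ : Fock (Orb (FermionTorus 2 L))) : ℝ :=
  shiftKinWeight (torusDiagJump L 0) ψ + shiftKinWeight (torusDiagJump L 1) ψ

/-- `K_{-j} = K_j` (relabel `z ↦ z + j` and conjugate). -/
theorem shiftKinWeight_neg (j : TorusSite 2 L) (ψ : Fock (Orb (FermionTorus 2 L))) :
    shiftKinWeight (-j) ψ = shiftKinWeight j ψ := by
  unfold shiftKinWeight
  rw [← Equiv.sum_comp (Equiv.addRight j)]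
  refine Finset.sum_congr rfl fun y _ => Finset.sum_congr rfl fun σ _ => ?_
  rw [Equiv.coe_addRight, add_neg_cancel_right,
    star_dotProduct_creation_mul_annihilation_mulVec_swap, Complex.conj_re]

/-- The orbital map of `r ∈ D₄` is `rotSite` on the site label. -/
private theorem d4Orb_r_one_orb' (z : TorusSite 2 L) (σ : Fin 2) :
    orb (FermionTorus.ofTorusSite (rotSite z)) σ =
      d4Orb (DihedralGroup.r 1 : DihedralGroup 4) (orb (FermionTorus.ofTorusSite z) σ) := by
  rw [← d4Site_r_one_eq']; simp [d4Orb, orb]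

/-- **`K_{rot j}(Γ(r)ψ) = K_j(ψ)`** for the second-quantised rotation `Γ(r)`. -/
theorem shiftKinWeight_rotSite_rot (j : TorusSite 2 L) (ψ : Fock (Orb (FermionTorus 2 L))) :
    shiftKinWeight (rotSite j) (fockMapOp (d4Orb (DihedralGroup.r 1 : DihedralGroup 4)) *ᵥ ψ) =
      shiftKinWeight j ψ := by
  unfold shiftKinWeight
  rw [← Equiv.sum_comp (d4SiteEquiv (L := L) (DihedralGroup.r 1 : DihedralGroup 4))]
  refine Finset.sum_congr rfl fun y _ => Finset.sum_congr rfl fun σ _ => ?_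
  rw [d4SiteEquiv_apply, d4Site_r_one_eq', ← rotSite_add, d4Orb_r_one_orb', d4Orb_r_one_orb',
    star_fockMapOp_mulVec_dotProduct_hop _ (d4Orb_bijective _)]

/-- **`K_diag(Γ(r)ψ) = K_diag(ψ)`** (the rotation swaps the two diagonal bond families). -/
theorem kinWeightDiag_rot (ψ : Fock (Orb (FermionTorus 2 L))) :
    kinWeightDiag (fockMapOp (d4Orb (DihedralGroup.r 1 : DihedralGroup 4)) *ᵥ ψ) =
      kinWeightDiag ψ := by
  have h0 : shiftKinWeight (torusDiagJump L 0)
      (fockMapOp (d4Orb (DihedralGroup.r 1 : DihedralGroup 4)) *ᵥ ψ) =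
      shiftKinWeight (torusDiagJump L 1) ψ := by
    rw [← rotSite_torusDiagJump_one, shiftKinWeight_rotSite_rot]
  have h1 : shiftKinWeight (torusDiagJump L 1)
      (fockMapOp (d4Orb (DihedralGroup.r 1 : DihedralGroup 4)) *ᵥ ψ) =
      shiftKinWeight (torusDiagJump L 0) ψ := by
    rw [← rotSite_neg_torusDiagJump_zero, shiftKinWeight_rotSite_rot, shiftKinWeight_neg]
  rw [kinWeightDiag, kinWeightDiag, h0, h1, add_comm]

/-- The fermion-labelled diagonal bond graph is invariant under the rotation `r`. -/
theorem fermionTorusDiagGraph_adj_rot (x y : FermionTorus 2 L) :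
    (fermionTorusDiagGraph L).Adj
        (FermionTorus.ofTorusEquiv (d4SiteEquiv (DihedralGroup.r 1 : DihedralGroup 4)) x)
        (FermionTorus.ofTorusEquiv (d4SiteEquiv (DihedralGroup.r 1 : DihedralGroup 4)) y) ↔
      (fermionTorusDiagGraph L).Adj x y := by
  simp only [fermionTorusDiagGraph, SimpleGraph.comap_adj, FermionTorus.toTorusSite_ofTorusEquiv,
    d4SiteEquiv_apply, d4Site_r_one_eq']
  exact torusDiagGraph_adj_rotSite_iff _ _

/-- **`Γ(r)` commutes with the `t–t'` Hamiltonian** (both bond graphs are rotation invariant). -/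
theorem fockMapOp_rot_mul_hubbardTorusTT' (t t' U : ℝ) :
    fockMapOp (d4Orb (DihedralGroup.r 1 : DihedralGroup 4)) * hubbardTorusTT' L t t' U =
      hubbardTorusTT' L t t' U * fockMapOp (d4Orb (DihedralGroup.r 1 : DihedralGroup 4)) := by
  have h2 : fockMapOp (d4Orb (DihedralGroup.r 1 : DihedralGroup 4)) *
      hamiltonian (fermionTorusDiagGraph L) t' 0 = hamiltonian (fermionTorusDiagGraph L) t' 0 *
        fockMapOp (d4Orb (DihedralGroup.r 1 : DihedralGroup 4)) :=
    fockMapOp_mapEquiv_mul_hamiltonian (fermionTorusDiagGraph L) (fermionTorusDiagGraph L)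
      (FermionTorus.ofTorusEquiv (d4SiteEquiv (DihedralGroup.r 1 : DihedralGroup 4)))
      fermionTorusDiagGraph_adj_rot t' 0
  change _ * (hubbardTorus 2 L t U + _) = (hubbardTorus 2 L t U + _) * _
  rw [Matrix.mul_add, Matrix.add_mul, fockMapOp_d4Orb_mul_hubbardTorus, h2]

/-- `Γ(r)` maps `(N, S^z = M)` sector ground states of the `t–t'` torus to sector ground states. -/
theorem isGroundStateInSector_hubbardTorusTT'_rot {t t' U : ℝ} {N : ℕ} {M : ℝ}
    {ψ : Fock (Orb (FermionTorus 2 L))}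
    (hψ : IsGroundStateInSector (hubbardTorusTT' L t t' U) N M ψ) :
    IsGroundStateInSector (hubbardTorusTT' L t t' U) N M
      (fockMapOp (d4Orb (DihedralGroup.r 1 : DihedralGroup 4)) *ᵥ ψ) := by
  obtain ⟨hmem, hne, heig⟩ := hψ
  refine ⟨fockMapOp_d4Orb_mulVec_mem_szSector _ hmem,
    fockMapOp_mulVec_ne_zero _ (d4Orb_bijective _).injective hne, ?_⟩
  rw [mulVec_mulVec, ← fockMapOp_rot_mul_hubbardTorusTT', ← mulVec_mulVec, heig, mulVec_smul]

/-- The `(2n, S^z = 0)` sector of the `t–t'` torus (`n ≤ L²`) has a unit ground state. -/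
theorem exists_unit_groundStateInSector_hubbardTorusTT' (L : ℕ) [NeZero L] (t t' U : ℝ)
    {n : ℕ} (hn : n ≤ L ^ 2) :
    ∃ ψ : Fock (Orb (FermionTorus 2 L)),
      star ψ ⬝ᵥ ψ = 1 ∧ IsGroundStateInSector (hubbardTorusTT' L t t' U) (2 * n) 0 ψ := by
  have hcard : n ≤ Fintype.card (FermionTorus 2 L) := by rwa [NoGo.card_fermionTorus_two]
  obtain ⟨⟨ψ, hψ⟩, -⟩ := LiebTwoHoppings.szSector_groundState₂ (fermionTorusGraph 2 L)
    (fermionTorusDiagGraph L) t t' U hcard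
  obtain ⟨c, hc, hc1⟩ := Literature.MathematicalPhysics.QuantumLattice.exists_smul_unit hψ.2.1
  exact ⟨c • ψ, hc1, NoGo.isGroundStateInSector_smul _ _ _ hψ hc⟩

end Summit.HubbardSuperconductivity.HubbardLadder.Bounds

end
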